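import Literature.Analysis.FluidPDE.HeatDuhamelBack
import HarnessLib

/-!
# Joint smoothness of the backward caloric Duhamel integral

Analysis/FluidPDE support file (layer 2 of the decomposition of `Literature.Analysis.FluidPDE.galdi_energy_equality`,
Galdi 2018, Thm. 1.1, class assertion `Literature.Analysis.FluidPDE.galdi_lerayHopf_class`: the duality argument tests
the very weak Navier–Stokes formulation `Fluid.IsWeakNSSolutionOn` — whose test fields must be
**jointly** smooth and compactly supported in space–time — with cut-offs of the backward caloric
Duhamel integral `U = 𝒰[Θ] = Fluid.heatDuhamelBack ν Θ` of a space–time test field `Θ`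
(`FluidPDE/HeatDuhamelBack`), so joint smoothness of `(s, x) ↦ U(s)(x)` is needed; the accepted
file proves `C²` in `x` and `C¹` in `s` separately).

**Main results** (all proved), for `Θ` a space–time test field on `ℝ × E` (`E` a
finite-dimensional real inner product space, values in a real Banach space `F`) and `0 < ν`:

* `Fluid.heatDuhamelKernel ν : ℝ × E → ℝ`, the **backward space–time heat kernel**
  `k(τ, y) = G_{ν|τ|}(y)` for `τ < 0` and `0` for `τ ≥ 0`; it is measurable, nonnegative, of unit
  spatial mass on `τ < 0`, and integrable on every time strip `[a, b] × E`
  (`integrableOn_heatDuhamelKernel_strip`), hence locally integrable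
  (`locallyIntegrable_heatDuhamelKernel`);
* `IsSpaceTimeTestOn.heatDuhamelBack_eq_convolution`: **`𝒰[Θ]` is a space–time convolution**,
  `𝒰[Θ](s)(x) = (k ⋆ Θ̃)(s, x) = ∫∫ k(τ, y) Θ̃((s, x) - (τ, y)) dτ dy` with `Θ̃ = uncurry Θ`
  (Fubini on the strip carrying `Θ(s - ·)`, the substitution `σ = -τ`, and
  `e^{tΔ}g(x) = ∫ G_t(y) g(x - y) dy`);
* `IsSpaceTimeTestOn.contDiff_uncurry_heatDuhamelBack`: **`(s, x) ↦ 𝒰[Θ](s)(x)` is `C^∞`**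
  (Mathlib's `HasCompactSupport.contDiff_convolution_right`: the convolution of a locally
  integrable kernel with a smooth compactly supported function is smooth).

This is the classical smoothness of the solution `U` of the backward heat problem
`∂ₛU + νΔU = -Θ`, `U = 0` after the support of `Θ`, for smooth compactly supported data
(Evans, *PDE*, 2nd ed., §2.3.1, Thm. 2 and its proof via the substituted Duhamel formula;
Lemarié-Rieusset 2016, Prop. 4.3, p. 74, the adjoint problem after time reversal).

## Mathlib / tree search

Mathlib (this pin) has the decisive `HasCompactSupport.contDiff_convolution_right`
(`Analysis/Calculus/ContDiff/Convolution`), Fubini (`integral_prod`, `integrable_prod_iff`),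
`integral_comp_neg_Ioi`; no heat kernel. The tree has `heatKernel`, `heatExtension`
(`UnboundedOperators/HeatKernel`), `Fluid.heatDuhamelBack` with its separate-variable calculus
(`FluidPDE/HeatDuhamelBack`); no joint smoothness statement (searched `contDiff` + `uncurry` +
`heatDuhamelBack`/`heatExtension`: only `contDiffOn_uncurry_heatExtension` on `t > 0`).

## References

* L. C. Evans, *Partial Differential Equations*, 2nd ed., AMS 2010, §2.3.1, Thm. 1–2.
* P. G. Lemarié-Rieusset, *The Navier–Stokes problem in the 21st century*, CRC Press 2016,
  Prop. 4.3, p. 74.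
* G. P. Galdi, *On the energy equality for distributional solutions to Navier–Stokes
  equations*, Proc. AMS 147 (2019), Thm. 1.1 (`Galdi2018`; the fact served).
-/

noncomputable section

open MeasureTheory TopologicalSpace Set Function Filter Topology ContinuousLinearMap
open scoped ENNReal NNReal Convolution ContDiff

namespace Literature.Analysis.FluidPDE

variable {E : Type*} [NormedAddCommGroup E] [InnerProductSpace ℝ E] [FiniteDimensional ℝ E]
  [MeasurableSpace E] [BorelSpace E]
variable {F : Type*} [NormedAddCommGroup F] [NormedSpace ℝ F]

/-! ### The backward space–time heat kernel -/

section Kernel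

/-- The **backward space–time heat kernel** with viscosity `ν`:
`heatDuhamelKernel ν (τ, y) = heatKernel (ν|τ|) y` for `τ < 0` and `0` for `τ ≥ 0`, so that the
backward Duhamel integral is the space–time convolution `𝒰[Θ] = heatDuhamelKernel ν ⋆ uncurry Θ`
(`IsSpaceTimeTestOn.heatDuhamelBack_eq_convolution`; Evans, *PDE*, §2.3.1, the kernel
`Φ(x - y, t - s)` of Duhamel's formula, reflected in time). [folklore] -/
def heatDuhamelKernel (ν : ℝ) (p : ℝ × E) : ℝ :=
  if p.1 < 0 then UnboundedOperators.heatKernel (ν * (-p.1)) p.2 else 0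

variable {ν : ℝ}

omit [FiniteDimensional ℝ E] [MeasurableSpace E] [BorelSpace E] in
/-- Unfolding the kernel at a negative time. [folklore] -/
theorem heatDuhamelKernel_of_neg {τ : ℝ} (hτ : τ < 0) (y : E) :
    heatDuhamelKernel ν (τ, y) = UnboundedOperators.heatKernel (ν * (-τ)) y := by
  simp [heatDuhamelKernel, hτ]

omit [FiniteDimensional ℝ E] [MeasurableSpace E] [BorelSpace E] in
/-- The kernel vanishes at nonnegative times. [folklore] -/
theorem heatDuhamelKernel_of_nonneg {τ : ℝ} (hτ : 0 ≤ τ) (y : E) :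
    heatDuhamelKernel ν (τ, y) = 0 := by
  simp [heatDuhamelKernel, not_lt.2 hτ]

omit [FiniteDimensional ℝ E] [MeasurableSpace E] [BorelSpace E] in
/-- The kernel is nonnegative (for `0 < ν`). [folklore] -/
theorem heatDuhamelKernel_nonneg (hν : 0 < ν) (p : ℝ × E) : 0 ≤ heatDuhamelKernel ν p := by
  unfold heatDuhamelKernel
  split_ifs with h
  · exact (UnboundedOperators.heatKernel_pos (mul_pos hν (neg_pos.2 h)) _).le
  · exact le_rfl

omit [FiniteDimensional ℝ E] in
/-- The kernel is measurable. [folklore] -/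
theorem measurable_heatDuhamelKernel (ν : ℝ) : Measurable (heatDuhamelKernel (E := E) ν) := by
  have h1 : Measurable fun p : ℝ × E => UnboundedOperators.heatKernel (ν * (-p.1)) p.2 := by
    unfold UnboundedOperators.heatKernel
    fun_prop
  unfold heatDuhamelKernel
  exact Measurable.ite (measurableSet_lt measurable_fst measurable_const) h1 measurable_const

/-- The spatial slices of the kernel are integrable. [folklore] -/
theorem integrable_heatDuhamelKernel_slice (hν : 0 < ν) (τ : ℝ) :
    Integrable (fun y : E => heatDuhamelKernel ν (τ, y)) volume := by
  by_cases hτ : τ < 0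
  · simp only [heatDuhamelKernel_of_neg hτ]
    exact UnboundedOperators.integrable_heatKernel_holds (mul_pos hν (neg_pos.2 hτ))
  · simp only [heatDuhamelKernel_of_nonneg (not_lt.1 hτ)]
    exact integrable_zero _ _ _

/-- The spatial mass of the kernel: `1` at negative times, `0` otherwise. [folklore] -/
theorem integral_heatDuhamelKernel_slice (hν : 0 < ν) (τ : ℝ) :
    ∫ y : E, heatDuhamelKernel ν (τ, y) = if τ < 0 then 1 else 0 := by
  by_cases hτ : τ < 0
  · simp only [heatDuhamelKernel_of_neg hτ, hτ, if_true]
    exact UnboundedOperators.integral_heatKernel_eq_one_holds (mul_pos hν (neg_pos.2 hτ))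
  · simp only [heatDuhamelKernel_of_nonneg (not_lt.1 hτ), hτ, if_false, integral_zero]

/-- The product Lebesgue measure restricted to a time strip. [folklore] -/
theorem volume_restrict_strip (S : Set ℝ) :
    (volume : Measure (ℝ × E)).restrict (S ×ˢ univ) =
      ((volume : Measure ℝ).restrict S).prod (volume : Measure E) := by
  rw [Measure.volume_eq_prod, ← Measure.prod_restrict, Measure.restrict_univ]

/-- **The kernel is integrable on every time strip** `S × E` with `S` of finite measure (its
spatial mass is at most `1`). [folklore] -/
theorem integrableOn_heatDuhamelKernel_strip (hν : 0 < ν) {S : Set ℝ} (hSfin : volume S ≠ ⊤) :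
    IntegrableOn (heatDuhamelKernel (E := E) ν) (S ×ˢ univ) volume := by
  rw [IntegrableOn, volume_restrict_strip]
  haveI : IsFiniteMeasure ((volume : Measure ℝ).restrict S) := ⟨by
    rw [Measure.restrict_apply_univ]; exact hSfin.lt_top⟩
  have hm : AEStronglyMeasurable (heatDuhamelKernel (E := E) ν)
      (((volume : Measure ℝ).restrict S).prod (volume : Measure E)) :=
    (measurable_heatDuhamelKernel ν).aestronglyMeasurable
  refine (integrable_prod_iff hm).2 ⟨Eventually.of_forall fun τ =>
    integrable_heatDuhamelKernel_slice hν τ, ?_⟩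
  refine Integrable.mono' (integrable_const (1 : ℝ)) ?_ (Eventually.of_forall fun τ => ?_)
  · exact hm.norm.integral_prod_right'
  · rw [Real.norm_eq_abs, abs_of_nonneg (integral_nonneg fun y => norm_nonneg _)]
    have : ∫ y : E, ‖heatDuhamelKernel ν (τ, y)‖ = ∫ y : E, heatDuhamelKernel ν (τ, y) :=
      integral_congr_ae (Eventually.of_forall fun y =>
        Real.norm_of_nonneg (heatDuhamelKernel_nonneg hν _))
    rw [this, integral_heatDuhamelKernel_slice hν]
    split_ifs <;> norm_num

/-- **The kernel is locally integrable** on `ℝ × E`. [folklore] -/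
theorem locallyIntegrable_heatDuhamelKernel (hν : 0 < ν) :
    LocallyIntegrable (heatDuhamelKernel (E := E) ν) volume := by
  refine locallyIntegrable_iff.2 fun K hK => ?_
  obtain ⟨R, hR⟩ := (hK.image continuous_fst).isBounded.subset_closedBall 0
  have hsub : K ⊆ Icc (-R) R ×ˢ (univ : Set E) := by
    intro p hp
    refine ⟨?_, mem_univ _⟩
    have h1 : p.1 ∈ Metric.closedBall (0 : ℝ) R := hR (mem_image_of_mem _ hp)
    rw [Metric.mem_closedBall, dist_zero_right, Real.norm_eq_abs, abs_le] at h1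
    exact h1
  exact (integrableOn_heatDuhamelKernel_strip hν
    (by rw [Real.volume_Icc]; exact ENNReal.ofReal_ne_top)).mono_set hsub

end Kernel

/-! ### The Duhamel integral as a space–time convolution -/

section Convolution

variable {ν : ℝ} {Θ : ℝ → E → F}

/-- The space–time convolution integrand is integrable: it is bounded by
`‖Θ‖_∞ · k · 1_{s - b ≤ τ ≤ s - a}` with `[a, b]` the time support of `Θ`. [folklore] -/
theorem IsSpaceTimeTestOn.integrable_heatDuhamelKernel_smul
    (hΘ : IsSpaceTimeTestOn (⊤ : Opens (ℝ × E)) Θ) (hν : 0 < ν) (s : ℝ) (x : E) :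
    Integrable (fun p : ℝ × E => heatDuhamelKernel ν p • uncurry Θ ((s, x) - p))
      (volume : Measure (ℝ × E)) := by
  obtain ⟨M, hM0, hM⟩ := hΘ.exists_norm_le
  obtain ⟨a, b, hab⟩ := hΘ.exists_time_support
  set S : Set ℝ := Icc (s - b) (s - a)
  have hK : IntegrableOn (heatDuhamelKernel (E := E) ν) (S ×ˢ univ) volume :=
    integrableOn_heatDuhamelKernel_strip hν
      (by rw [Real.volume_Icc]; exact ENNReal.ofReal_ne_top)
  have hKi : Integrable ((S ×ˢ (univ : Set E)).indicator (heatDuhamelKernel (E := E) ν))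
      (volume : Measure (ℝ × E)) :=
    (integrable_indicator_iff (measurableSet_Icc.prod MeasurableSet.univ)).2 hK
  have hm : AEStronglyMeasurable (fun p : ℝ × E => heatDuhamelKernel ν p • uncurry Θ ((s, x) - p))
      (volume : Measure (ℝ × E)) := by
    refine (measurable_heatDuhamelKernel ν).aestronglyMeasurable.smul ?_
    exact (hΘ.continuous_uncurry.comp (continuous_const.sub continuous_id)).aestronglyMeasurable
  refine Integrable.mono' (hKi.norm.mul_const M) hm (Eventually.of_forall fun p => ?_)
  rw [norm_smul]
  by_cases hp : p ∈ S ×ˢ (univ : Set E)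
  · rw [indicator_of_mem hp]
    exact mul_le_mul_of_nonneg_left (hM _ _) (norm_nonneg _)
  · have h1 : p.1 ∉ S := fun h => hp ⟨h, mem_univ _⟩
    have h2 : Θ (s - p.1) = 0 := hab _ fun h => h1 ⟨by linarith [h.2], by linarith [h.1]⟩
    have h3 : uncurry Θ ((s, x) - p) = 0 := by
      simp only [uncurry, Prod.fst_sub, Prod.snd_sub, h2, Pi.zero_apply]
    rw [h3, norm_zero, mul_zero]
    exact mul_nonneg (norm_nonneg _) hM0

/-- **The backward Duhamel integral is a space–time convolution**:
`𝒰[Θ](s)(x) = (heatDuhamelKernel ν ⋆ uncurry Θ)(s, x)` (Evans, *PDE*, §2.3.1, Duhamel's formula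
in the substituted form; here for the backward problem). Proof: Fubini on the product
`ℝ × E`, the slice at `τ < 0` being `∫ G_{ν|τ|}(y) Θ(s - τ)(x - y) dy = (e^{ν|τ|Δ}Θ(s - τ))(x)`,
and the substitution `σ = -τ`. [folklore] -/
theorem IsSpaceTimeTestOn.heatDuhamelBack_eq_convolution [CompleteSpace F]
    (hΘ : IsSpaceTimeTestOn (⊤ : Opens (ℝ × E)) Θ) (hν : 0 < ν) (s : ℝ) (x : E) :
    heatDuhamelBack ν Θ s x =
      (heatDuhamelKernel ν ⋆[lsmul ℝ ℝ, (volume : Measure (ℝ × E))] uncurry Θ) (s, x) := by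
  rw [convolution_def]
  simp only [lsmul_apply]
  rw [Measure.volume_eq_prod, integral_prod _ (by
    rw [← Measure.volume_eq_prod]; exact hΘ.integrable_heatDuhamelKernel_smul hν s x)]
  -- the time slices
  have hslice : ∀ τ : ℝ, (∫ y : E, heatDuhamelKernel ν (τ, y) • uncurry Θ ((s, x) - (τ, y))) =
      if τ < 0 then UnboundedOperators.heatExtension (Θ (s - τ)) (ν * (-τ)) x else 0 := by
    intro τ
    by_cases hτ : τ < 0
    · simp only [heatDuhamelKernel_of_neg hτ, hτ, if_true, uncurry, Prod.fst_sub, Prod.snd_sub,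
        UnboundedOperators.heatExtension_apply]
    · simp only [heatDuhamelKernel_of_nonneg (not_lt.1 hτ), hτ, if_false, zero_smul,
        integral_zero]
  simp_rw [hslice]
  have hind : (fun τ : ℝ => if τ < 0 then UnboundedOperators.heatExtension (Θ (s - τ)) (ν * (-τ)) x else 0) =
      (Iio (0 : ℝ)).indicator fun τ => UnboundedOperators.heatExtension (Θ (s - τ)) (ν * (-τ)) x := by
    funext τ
    simp only [Set.indicator_apply, mem_Iio]
  rw [hind, integral_indicator measurableSet_Iio, ← integral_Iic_eq_integral_Iio,
    heatDuhamelBack_apply]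
  have h := integral_comp_neg_Ioi 0 (fun τ => UnboundedOperators.heatExtension (Θ (s - τ)) (ν * (-τ)) x)
  simp only [neg_zero, sub_neg_eq_add, neg_neg] at h
  exact h

end Convolution

/-! ### Joint smoothness -/

section Smooth

variable {ν : ℝ} {Θ : ℝ → E → F}

/-- **The backward caloric Duhamel integral of a space–time test field is jointly smooth**:
`(s, x) ↦ 𝒰[Θ](s)(x)` is `C^n` on `ℝ × E` for every `n ≤ ∞` (Evans, *PDE*, §2.3.1, Thm. 2,
`u ∈ C^∞` for smooth compactly supported data; here by the convolution representation
`𝒰[Θ] = heatDuhamelKernel ν ⋆ uncurry Θ` and Mathlib's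
`HasCompactSupport.contDiff_convolution_right`). [folklore] -/
theorem IsSpaceTimeTestOn.contDiff_uncurry_heatDuhamelBack [CompleteSpace F]
    (hΘ : IsSpaceTimeTestOn (⊤ : Opens (ℝ × E)) Θ) (hν : 0 < ν) {n : ℕ∞} :
    ContDiff ℝ n (uncurry (heatDuhamelBack ν Θ)) := by
  have hg : ContDiff ℝ n (uncurry Θ) := hΘ.contDiff.of_le (by exact_mod_cast le_top)
  have h := hΘ.hasCompactSupport.contDiff_convolution_right (lsmul ℝ ℝ)
    (locallyIntegrable_heatDuhamelKernel (E := E) hν) hg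
  have heq : uncurry (heatDuhamelBack ν Θ) =
      (heatDuhamelKernel ν ⋆[lsmul ℝ ℝ, (volume : Measure (ℝ × E))] uncurry Θ) := by
    funext p
    exact hΘ.heatDuhamelBack_eq_convolution hν p.1 p.2
  rw [heq]
  exact h

/-- The same with the smoothness exponent `∞`, in the form consumed by
`Fluid.IsSpaceTimeTestOn`/`Literature.Analysis.FunctionSpaces.IsTestFunctionOn`. [folklore] -/
theorem IsSpaceTimeTestOn.contDiff_uncurry_heatDuhamelBack_infty [CompleteSpace F]
    (hΘ : IsSpaceTimeTestOn (⊤ : Opens (ℝ × E)) Θ) (hν : 0 < ν) :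
    ContDiff ℝ ∞ (uncurry (heatDuhamelBack ν Θ)) :=
  hΘ.contDiff_uncurry_heatDuhamelBack hν

/-- Joint smoothness of a product `(s, x) ↦ ζ(s) χ(x) • 𝒰[Θ](s)(x)` with smooth scalar factors
(the cut-off test fields of the duality argument). [folklore] -/
theorem IsSpaceTimeTestOn.contDiff_uncurry_smul_heatDuhamelBack [CompleteSpace F]
    (hΘ : IsSpaceTimeTestOn (⊤ : Opens (ℝ × E)) Θ) (hν : 0 < ν) {ζ : ℝ → ℝ} {χ : E → ℝ}
    (hζ : ContDiff ℝ ∞ ζ) (hχ : ContDiff ℝ ∞ χ) :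
    ContDiff ℝ ∞ (uncurry fun s x => (ζ s * χ x) • heatDuhamelBack ν Θ s x) := by
  have h1 : ContDiff ℝ ∞ fun p : ℝ × E => ζ p.1 * χ p.2 :=
    (hζ.comp contDiff_fst).mul (hχ.comp contDiff_snd)
  exact h1.smul (hΘ.contDiff_uncurry_heatDuhamelBack_infty hν)

end Smooth

end Literature.Analysis.FluidPDE
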